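import Mathlib
import Literature.Computability.Complexity.RandomKSatEnsembleOGP
import Summits.PneNP.PneNP.Theorems.OverlapGapAlgebraNoStableSectionDefs
import Summits.PneNP.PneNP.Theorems.OverlapGapAlgebraNoStableSectionCount
import Summits.PneNP.PneNP.Theorems.OverlapGapAlgebraSearchHardWindowLowEntropyCount

/-!
# Route OverlapGapAlgebra, crux `SearchHardWindow` (stmt-PneNP-2460), line `Sketch`: few banded
# tuples

Stub `stub_bandCount` of the skeleton
`Summits/PneNP/PneNP/Cruxes/SearchHardWindow/Lines/Sketch.lean` (section `EnsembleOGP`), the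
counting half of the first moment behind the ensemble OGP (Huang–Sellke 2025, arXiv:2501.06427,
Lemma 3.22; Bresler–Huang 2021, arXiv:2106.02129, §4.6 and Lemma 5.1, method of types): the tuples
`Y 0, …, Y k : Fin n → Bool` all of whose (Bresler–Huang) conditional overlap entropies
`overlapCondEnt (seqOf Y) ℓ`, `1 ≤ ℓ ≤ k`, are `≤ β` number at most `2^n ((n+1)^{2^k} e^{nβ})^k`.

Proof: induction on `k`, peeling the LAST rung `Y ↦ (Fin.init Y, Y (Fin.last _))`, exactly as in
the DartGame count `card_filter_tuple_condEnt_le`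
(`Summits/PneNP/PneNP/Theorems/OverlapGapAlgebraNoStableSectionCount.lean`), with the one-rung count
`stub_lowEntropyCount` (`≤ (n+1)^{2^j} e^{nβ}` candidates of conditional overlap entropy `≤ β` over
any prefix of `j ≥ 1` rungs) in place of `card_filter_condEnt_le`. The only new ingredient is the
congruence `bct_overlapCondEnt_congr`: `overlapCondEnt Z ℓ` reads only the rungs `Z 0, …, Z ℓ` (it
is the DartGame `condEnt` of the rung-`0`-normalised sequence, `mtr_overlapCondEnt_eq_condEnt`, and
`condEnt_congr` applies), whence the band conditions at the rungs `ℓ ≤ k` of `Y` are those of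
`Fin.init Y` (`bct_overlapCondEnt_seqOf_init`) and the condition at the last rung is that of the
last entry as a candidate over the truncated tuple (`bct_overlapCondEnt_seqOf_last`). Finally
`T(k) · (n+1)^{2^{k+1}} e^{nβ} ≤ 2^n ((n+1)^{2^{k+1}} e^{nβ})^{k+1}` by monotonicity in the exponent
`2^k ≤ 2^{k+1}` (`n + 1 ≥ 1`).
-/

set_option linter.dupNamespace false -- `Summit.PneNP.PneNP.…`: summit = sub-problem

namespace Summit.PneNP.PneNP.Theorems

open Finset
open Literature.Computability.Complexity
open Summit.PneNP.PneNP.Cruxes.NoStableSection.DartGame (seqOf seqOf_apply_lt condEnt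
  condEnt_congr cnt_seqOf_init)
open scoped Classical

/-- `overlapCondEnt Z ℓ` only reads the rungs `Z 0, …, Z ℓ`. -/
theorem bct_overlapCondEnt_congr {n : ℕ} {Z Z' : ℕ → Fin n → Bool} {ℓ : ℕ}
    (h : ∀ j ≤ ℓ, Z j = Z' j) : overlapCondEnt Z ℓ = overlapCondEnt Z' ℓ := by
  rw [mtr_overlapCondEnt_eq_condEnt, mtr_overlapCondEnt_eq_condEnt]
  refine condEnt_congr fun j hj => ?_
  funext i
  rw [h j hj, h 0 (Nat.zero_le ℓ)]

/-- The conditional overlap entropies of the rungs below the last one are those of the truncated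
tuple. -/
theorem bct_overlapCondEnt_seqOf_init {n L : ℕ} (Y : Fin (L + 1) → Fin n → Bool) {ℓ : ℕ}
    (hℓ : ℓ < L) : overlapCondEnt (seqOf (Fin.init Y)) ℓ = overlapCondEnt (seqOf Y) ℓ :=
  bct_overlapCondEnt_congr fun _ hj => cnt_seqOf_init Y (by omega)

/-- The conditional overlap entropy of the last rung is that of the last entry as a candidate over
the truncated tuple (the prefix-and-candidate sequence in the `if`-form of `stub_lowEntropyCount`). -/
theorem bct_overlapCondEnt_seqOf_last {n L : ℕ} (Y : Fin (L + 1) → Fin n → Bool) :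
    overlapCondEnt (seqOf Y) L =
      overlapCondEnt (fun ℓ => if ℓ < L then seqOf (Fin.init Y) ℓ else Y (Fin.last L)) L := by
  refine bct_overlapCondEnt_congr fun j hj => ?_
  show seqOf Y j = if j < L then seqOf (Fin.init Y) j else Y (Fin.last L)
  rcases Nat.lt_or_ge j L with h | h
  · rw [if_pos h, cnt_seqOf_init Y h]
  · have hjL : j = L := le_antisymm hj h
    subst hjL
    rw [if_neg (lt_irrefl j), seqOf_apply_lt Y (Nat.lt_succ_self j)]
    rfl

/-- **Few banded tuples** (stub `stub_bandCount` of line `Sketch`, section `EnsembleOGP`; method of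
types, Bresler–Huang 2021 §4.6 / Lemma 5.1 made exact): the tuples `Y 0, …, Y k : Fin n → Bool` all
of whose conditional overlap entropies at the rungs `1, …, k` are `≤ β` number at most
`2^n ((n+1)^{2^k} e^{nβ})^k` — by induction on `k`, peeling the last rung and applying
`stub_lowEntropyCount` over the truncated tuple. -/
theorem stub_bandCount (n k : ℕ) (β : ℝ) (hβ : 0 ≤ β) :
    ((univ.filter fun Y : Fin (k + 1) → Fin n → Bool =>
        ∀ ℓ : ℕ, 1 ≤ ℓ → ℓ ≤ k → overlapCondEnt (seqOf Y) ℓ ≤ β).card : ℝ) ≤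
      (2 : ℝ) ^ n * (((n : ℝ) + 1) ^ (2 ^ k) * Real.exp (n * β)) ^ k := by
  have _ := hβ
  induction k with
  | zero =>
    -- the band condition is vacuous: all `2^n` one-entry tuples
    rw [pow_zero, mul_one]
    have h := card_le_univ (univ.filter fun Y : Fin (0 + 1) → Fin n → Bool =>
        ∀ ℓ : ℕ, 1 ≤ ℓ → ℓ ≤ 0 → overlapCondEnt (seqOf Y) ℓ ≤ β)
    rw [Fintype.card_fun, Fintype.card_fun, Fintype.card_bool, Fintype.card_fin,
      Fintype.card_fin, pow_one] at h
    exact_mod_cast h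
  | succ k ih =>
    set T' := univ.filter fun Y : Fin (k + 1 + 1) → Fin n → Bool =>
        ∀ ℓ : ℕ, 1 ≤ ℓ → ℓ ≤ k + 1 → overlapCondEnt (seqOf Y) ℓ ≤ β with hT'
    set T := univ.filter fun Y : Fin (k + 1) → Fin n → Bool =>
        ∀ ℓ : ℕ, 1 ≤ ℓ → ℓ ≤ k → overlapCondEnt (seqOf Y) ℓ ≤ β with hT
    -- (a) truncation maps banded tuples to banded tuples
    have hmaps : (T' : Set (Fin (k + 1 + 1) → Fin n → Bool)).MapsTo (fun Y => Fin.init Y) T := by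
      intro Y hY
      rw [mem_coe, hT', mem_filter] at hY
      rw [mem_coe, hT, mem_filter]
      refine ⟨mem_univ _, fun ℓ h1 hk => ?_⟩
      rw [bct_overlapCondEnt_seqOf_init Y (Nat.lt_succ_of_le hk)]
      exact hY.2 ℓ h1 (Nat.le_succ_of_le hk)
    -- (b) count fibrewise over the truncation
    have hsum : T'.card = ∑ Y' ∈ T, (T'.filter fun Y => Fin.init Y = Y').card :=
      card_eq_sum_card_fiberwise hmaps
    -- (c) a fibre injects (by the last entry) into the candidates of low conditional overlap
    -- entropy over the prefix, which `stub_lowEntropyCount` counts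
    have hfib : ∀ Y' ∈ T, ((T'.filter fun Y => Fin.init Y = Y').card : ℝ) ≤
        ((n : ℝ) + 1) ^ (2 ^ (k + 1)) * Real.exp (n * β) := by
      intro Y' _
      calc ((T'.filter fun Y => Fin.init Y = Y').card : ℝ)
          ≤ ((univ.filter fun x : Fin n → Bool =>
              overlapCondEnt (fun ℓ => if ℓ < k + 1 then seqOf Y' ℓ else x) (k + 1) ≤ β).card :
                ℝ) := by
            have h := card_le_card_of_injOn (s := T'.filter fun Y => Fin.init Y = Y')
              (t := univ.filter fun x : Fin n → Bool =>
                overlapCondEnt (fun ℓ => if ℓ < k + 1 then seqOf Y' ℓ else x) (k + 1) ≤ β)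
              (fun Y => Y (Fin.last (k + 1))) ?_ ?_
            · exact_mod_cast h
            · intro Y hY
              rw [mem_coe, mem_filter] at hY
              obtain ⟨hY, hYi⟩ := hY
              rw [hT', mem_filter] at hY
              rw [mem_coe, mem_filter]
              refine ⟨mem_univ _, ?_⟩
              have := hY.2 (k + 1) (Nat.le_add_left 1 k) le_rfl
              rw [bct_overlapCondEnt_seqOf_last Y, hYi] at this
              exact this
            · intro Y₁ h₁ Y₂ h₂ h
              rw [mem_coe, mem_filter] at h₁ h₂
              have h' : Y₁ (Fin.last (k + 1)) = Y₂ (Fin.last (k + 1)) := h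
              rw [← Fin.snoc_init_self Y₁, ← Fin.snoc_init_self Y₂, h₁.2, h₂.2, h']
        _ ≤ ((n : ℝ) + 1) ^ (2 ^ (k + 1)) * Real.exp (n * β) :=
            stub_lowEntropyCount n (k + 1) (Nat.le_add_left 1 k) (seqOf Y') β
    -- (d) assemble with the induction hypothesis
    have hmono : ((n : ℝ) + 1) ^ (2 ^ k) * Real.exp (n * β) ≤
        ((n : ℝ) + 1) ^ (2 ^ (k + 1)) * Real.exp (n * β) := by
      have h2k : 2 ^ k ≤ 2 ^ (k + 1) := Nat.pow_le_pow_right (by norm_num) (Nat.le_succ k)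
      have hn1 : (1 : ℝ) ≤ (n : ℝ) + 1 := by linarith [(Nat.cast_nonneg n : (0 : ℝ) ≤ n)]
      exact mul_le_mul_of_nonneg_right (pow_le_pow_right₀ hn1 h2k) (Real.exp_pos _).le
    calc (T'.card : ℝ) = ∑ Y' ∈ T, ((T'.filter fun Y => Fin.init Y = Y').card : ℝ) := by
          rw [hsum]
          push_cast
          rfl
      _ ≤ ∑ Y' ∈ T, ((n : ℝ) + 1) ^ (2 ^ (k + 1)) * Real.exp (n * β) := sum_le_sum hfib
      _ = T.card * (((n : ℝ) + 1) ^ (2 ^ (k + 1)) * Real.exp (n * β)) := by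
          rw [sum_const, nsmul_eq_mul]
      _ ≤ (2 : ℝ) ^ n * (((n : ℝ) + 1) ^ (2 ^ k) * Real.exp (n * β)) ^ k *
            (((n : ℝ) + 1) ^ (2 ^ (k + 1)) * Real.exp (n * β)) := by
          gcongr
      _ ≤ (2 : ℝ) ^ n * (((n : ℝ) + 1) ^ (2 ^ (k + 1)) * Real.exp (n * β)) ^ k *
            (((n : ℝ) + 1) ^ (2 ^ (k + 1)) * Real.exp (n * β)) := by
          gcongr
      _ = (2 : ℝ) ^ n * (((n : ℝ) + 1) ^ (2 ^ (k + 1)) * Real.exp (n * β)) ^ (k + 1) := by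
          ring

end Summit.PneNP.PneNP.Theorems
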